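import Summits.AtomisticToContinuum.Crystallization.Theses.IsometryAtoms
import Summits.AtomisticToContinuum.Crystallization.Theorems.MinimisingLawsCohesive.Negative.OnePointMixtures
import Summits.AtomisticToContinuum.Crystallization.Theorems.PalmUnimodularRigidityMinimiserShellsEnergyFloor

/-!
# Negative knowledge for crux `MinimisingLawsCohesive` (stmt-AtomisticToContinuum-15777), III:
# the exact face — the floor is a tree theorem, so the crux is cohesion of EXACT laws; and
# normalisation is load-bearing

Standing crux disprover `cdisprove-stmt-AtomisticToContinuum-15777` (cycle 1,
`--supports stmt-AtomisticToContinuum-15777`; parts I–II are `OnePointMixtures.lean`,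
`RootedComb.lean` of the vetting refuter).

The energy floor `e* ≤ E_P[rootEnergy]` for every point-stationary a.s.-hard-core probability law
is PROVED in the tree (`PalmUnimodularRigidityMinimiserShells.EnergyFloor.stub_energyFloor`, item
9229, random-grid mass transport).  Consequences recorded here (all `[folklore]`):

* `energyFloor'` — the floor in the vocabulary of the crux; `minimising_iff_exact` — under the
  frame `∫ rootEnergy ≤ e* ↔ ∫ rootEnergy = e*`; `isLeast_eStar` — `e*` (the periodic infimum) IS
  the least mean root energy over the frame and is attained (`exists_minimising_law`): the frame of
  the crux is canonical.
* `minimisingLawsCohesive_iff_exact` — the stability conjunct of part I's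
  `minimisingLawsCohesive_iff_stable_and_exact` is discharged: the crux is EXACTLY cohesion of the
  laws at energy `e*`; `not_minimisingLawsCohesive_iff` — the KILL SHAPE as an iff: a refutation is
  precisely an exact admissible law charging configurations with unbounded holes (nothing cheaper
  works, nothing more is needed).
* `not_cohesive_without_probability` — (H_P) the hypothesis `IsProbabilityMeasure P` is
  load-bearing: for FINITE laws the crux fails (`P_min + δ_{δ_0}`, mass 2, energy `e* + 0 ≤ e*`,
  charges `δ_0`); sub-probability laws satisfy it vacuously (normalising would go below the floor),
  so exactly `P univ = 1` is used, through the normalisation of the threshold.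
-/

noncomputable section

namespace Summit.AtomisticToContinuum.Crystallization.Theorems.MinimisingLawsCohesive.Negative

open MeasureTheory Set Filter
open scoped ENNReal Topology
open Literature.MathematicalPhysics.StatisticalMechanics Literature.Probability.Process
open Summit.AtomisticToContinuum.Crystallization.Theses.IsometryAtoms (MinimisingLawsCohesive)
open Summit.AtomisticToContinuum.Crystallization.Theorems.ChargedEnergyGapNegative (eStar)
open Summit.AtomisticToContinuum.Crystallization.Theorems.MinimisingLawsCohesive.Negative.OnePointMixtures
  (exists_minimising_law integrable_of_integral_le_eStar rootEnergy_ae_eq_zero_dirac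
    not_relDense_dirac_zero minimisingLawsCohesive_iff_stable_and_exact)

/-! ## §1 The exact face -/

/-- **The energy floor, in the vocabulary of the crux** (tree theorem
`PalmUnimodularRigidityMinimiserShells.EnergyFloor.stub_energyFloor`, item 9229, random-grid mass
transport): `e* ≤ E_P[rootEnergy]` for every point-stationary a.s.-`δ`-hard-core probability law.
[folklore] -/
theorem energyFloor' {δ : ℝ} (hδ : 0 < δ) (P : Measure (Measure (EuclideanSpace ℝ (Fin 3))))
    [hP : IsProbabilityMeasure P] (hhc : ∀ᵐ μ ∂P, IsRootedHardCore δ μ) (hst : IsPointStationaryLaw P) :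
    eStar ≤ ∫ μ, rootEnergy lennardJones μ ∂P :=
  Summit.AtomisticToContinuum.Crystallization.Theorems.PalmUnimodularRigidityMinimiserShells.EnergyFloor.stub_energyFloor
    δ hδ P hP hhc hst

/-- **Minimising = exact.** Under the frame, the minimising hypothesis `∫ rootEnergy ≤ e*` holds iff
the mean root energy is EXACTLY `e*`. [folklore] -/
theorem minimising_iff_exact {δ : ℝ} (hδ : 0 < δ) (P : Measure (Measure (EuclideanSpace ℝ (Fin
    3)))) [IsProbabilityMeasure P]
    (hhc : ∀ᵐ μ ∂P, IsRootedHardCore δ μ) (hst : IsPointStationaryLaw P) :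
    (∫ μ, rootEnergy lennardJones μ ∂P) ≤ eStar ↔ (∫ μ, rootEnergy lennardJones μ ∂P) = eStar :=
  ⟨fun h => le_antisymm h (energyFloor' hδ P hhc hst), fun h => h.le⟩

/-- **`e*` is the least mean root energy over the frame, and it is attained** (by the
Benjamini–Schramm limit law of Lennard-Jones ground states, `exists_minimising_law`): the periodic
infimum `⨅_Q e_LJ(Q)` IS the minimum of `E_P[rootEnergy]` over point-stationary hard-core
probability
laws. So the frame of the crux is the canonical one (no gap between "≤ periodic infimum" and
"minimising among admissible laws"). [folklore] -/
theorem isLeast_eStar :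
    IsLeast {e : ℝ | ∃ δ : ℝ, 0 < δ ∧ ∃ P : Measure (Measure (EuclideanSpace ℝ (Fin 3))),
        IsProbabilityMeasure P ∧
      (∀ᵐ μ ∂P, IsRootedHardCore δ μ) ∧ IsPointStationaryLaw P ∧
      ∫ μ, rootEnergy lennardJones μ ∂P = e} eStar := by
  refine ⟨exists_minimising_law, ?_⟩
  rintro e ⟨δ, hδ, P, hP, hhc, hst, rfl⟩
  exact energyFloor' hδ P hhc hst

/-- **The crux is cohesion of exact laws.** With the floor a tree theorem, the stability conjunct of
the landed splitting `minimisingLawsCohesive_iff_stable_and_exact` is discharged: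
`MinimisingLawsCohesive ↔` every point-stationary a.s.-hard-core probability law with
`E_P[rootEnergy] = e*` is a.s. relatively dense. [folklore] -/
theorem minimisingLawsCohesive_iff_exact :
    MinimisingLawsCohesive ↔
      ∀ δ : ℝ, 0 < δ → ∀ P : Measure (Measure (EuclideanSpace ℝ (Fin 3))), IsProbabilityMeasure P →
        (∀ᵐ μ ∂P, IsRootedHardCore δ μ) → IsPointStationaryLaw P →
        (∫ μ, rootEnergy lennardJones μ ∂P) = eStar → ∀ᵐ μ ∂P,
          ∃ R₀ : ℝ, ∀ z : (EuclideanSpace ℝ (Fin 3)), ∃ y : (EuclideanSpace ℝ (Fin 3)), μ {y} ≠ 0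
              ∧ dist z y ≤ R₀ := by
  rw [minimisingLawsCohesive_iff_stable_and_exact]
  exact ⟨fun h => h.2, fun h => ⟨fun δ hδ P hP hhc hst => energyFloor' hδ P hhc hst, h⟩⟩

/-- **KILL SHAPE (iff).** The crux fails iff there is a point-stationary a.s.-hard-core probability
law with mean root energy EXACTLY `e*` that charges non-relatively-dense configurations. Nothing
cheaper can refute it (mixtures, relaxed energies, non-stationary samples are all excluded by the
landed Negative lemmas), and nothing more is needed. [folklore] -/
theorem not_minimisingLawsCohesive_iff :
    ¬ MinimisingLawsCohesive ↔
      ∃ δ : ℝ, 0 < δ ∧ ∃ P : Measure (Measure (EuclideanSpace ℝ (Fin 3))), IsProbabilityMeasure P ∧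
        (∀ᵐ μ ∂P, IsRootedHardCore δ μ) ∧ IsPointStationaryLaw P ∧
        (∫ μ, rootEnergy lennardJones μ ∂P) = eStar ∧ ¬ ∀ᵐ μ ∂P,
          ∃ R₀ : ℝ, ∀ z : (EuclideanSpace ℝ (Fin 3)), ∃ y : (EuclideanSpace ℝ (Fin 3)), μ {y} ≠ 0
              ∧ dist z y ≤ R₀ := by
  rw [minimisingLawsCohesive_iff_exact]
  constructor
  · intro h
    by_contra hne
    refine h fun δ hδ P hP hhc hst hE => ?_
    by_contra hbad
    exact hne ⟨δ, hδ, P, hP, hhc, hst, hE, hbad⟩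
  · rintro ⟨δ, hδ, P, hP, hhc, hst, hE, hbad⟩ h
    exact hbad (h δ hδ P hP hhc hst hE)

/-! ## §2 (H_P): normalisation is load-bearing -/

/-- **(H_P) Normalisation is load-bearing.** With `IsProbabilityMeasure P` weakened to
`IsFiniteMeasure P` (everything else verbatim) the crux fails:
`P_min + δ_{δ_0}` (the exact Benjamini–Schramm law of ground states plus the one-point law) is
point-stationary (the Mecke laws form a cone), a.s. hard-core, has mean root energy `e* + 0 ≤ e*`,
and charges the configuration `δ_0`, which is not relatively dense. (For SUB-probability `P` of
mass `c < 1` the statement is vacuously true: `P/c` would be an admissible probability law below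
the floor. So exactly `P univ = 1` is used, through the normalisation `e* · P(univ)` of the energy
threshold.) [folklore] -/
theorem not_cohesive_without_probability :
    ¬ (∀ δ : ℝ, 0 < δ → ∀ P : Measure (Measure (EuclideanSpace ℝ (Fin 3))), IsFiniteMeasure P →
        (∀ᵐ μ ∂P, IsRootedHardCore δ μ) → IsPointStationaryLaw P →
        (∫ μ, rootEnergy lennardJones μ ∂P) ≤
          (⨅ Q : PeriodicConfiguration 3, Q.energyPerParticle lennardJones) →
        ∀ᵐ μ ∂P, ∃ R₀ : ℝ, ∀ z : (EuclideanSpace ℝ (Fin 3)), ∃ y : (EuclideanSpace ℝ (Fin 3)),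
          μ {y} ≠ 0 ∧ dist z y ≤ R₀) := by
  intro H
  obtain ⟨δ, hδ, P, hP, hhc, hst, hE⟩ := exists_minimising_law
  set D : Measure (Measure (EuclideanSpace ℝ (Fin 3))) := Measure.dirac (Measure.dirac (0 :
      (EuclideanSpace ℝ (Fin 3)))) with hD
  have hint : Integrable (fun μ : Measure (EuclideanSpace ℝ (Fin 3)) => rootEnergy lennardJones
      μ) P :=
    integrable_of_integral_le_eStar hE.le
  have hintD : Integrable (fun μ : Measure (EuclideanSpace ℝ (Fin 3)) => rootEnergy lennardJones
      μ) D :=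
    (integrable_congr rootEnergy_ae_eq_zero_dirac).2 (integrable_const _)
  have hED : ∫ μ, rootEnergy lennardJones μ ∂D = 0 := by
    rw [integral_congr_ae rootEnergy_ae_eq_zero_dirac, integral_const, smul_zero]
  have hfin : IsFiniteMeasure (P + D) := by infer_instance
  have hhc' : ∀ᵐ μ ∂(P + D), IsRootedHardCore δ μ := by
    rw [ae_add_measure_iff]
    exact ⟨hhc, (ae_dirac_dirac_zero (measurableSet_singleton (0 : (EuclideanSpace ℝ (Fin
        3))))).mono
      fun μ hμ => hμ ▸ isRootedHardCore_dirac_zero δ⟩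
  have hst' : IsPointStationaryLaw (P + D) := hst.add isPointStationaryLaw_dirac_dirac_zero
  have hE' : (∫ μ, rootEnergy lennardJones μ ∂(P + D)) ≤
      (⨅ Q : PeriodicConfiguration 3, Q.energyPerParticle lennardJones) := by
    rw [integral_add_measure hint hintD, hE, hED, add_zero]
    exact le_rfl
  have hconc := H δ hδ (P + D) hfin hhc' hst' hE'
  rw [ae_iff] at hconc
  set s : Set (Measure (EuclideanSpace ℝ (Fin 3))) := {μ | ¬ ∃ R₀ : ℝ, ∀ z : (EuclideanSpace ℝ
      (Fin 3)), ∃ y : (EuclideanSpace ℝ (Fin 3)), μ {y} ≠ 0 ∧ dist z y ≤ R₀}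
    with hs
  have hmem : Measure.dirac (0 : (EuclideanSpace ℝ (Fin 3))) ∈ s := not_relDense_dirac_zero
  have h1 : (1 : ℝ≥0∞) ≤ D s := by
    refine le_trans (le_of_eq ?_) Measure.le_dirac_apply
    rw [indicator_of_mem hmem, Pi.one_apply]
  have h2 : (1 : ℝ≥0∞) ≤ (P + D) s := h1.trans (by rw [Measure.add_apply]; exact le_add_self)
  rw [hconc] at h2
  exact one_ne_zero (nonpos_iff_eq_zero.1 h2)

end Summit.AtomisticToContinuum.Crystallization.Theorems.MinimisingLawsCohesive.Negative

end
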